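import Summits.QuantumFields.BalabanUV.Beta.FP.ValueFunctionThirdJet

/-!
# `BalabanUV.Beta.FP.ValueFunctionThirdJetEnvelope` — road «FP» for binder row D1, row **H2V-4′-a (MODEL)**, sequel of `FP/ValueFunctionThirdJet`:
# **THE THIRD JET OF THE TREE-LEVEL EFFECTIVE ACTION** `V := A ∘ U` —
# `D³V(c₀)[a,a,a] = A‴[Ha,Ha,Ha] − 3·(Δa) ⬝ ∂²Q[Ha,Ha]`, `H := minOp H_c J_c`, `Δ := effForm H_c J_c`, at a tadpole-free base point

HONEST DEPENDENCY (cell records, verbatim): «continuum YM on T⁴ ⇐ BetaPertH ∧ nine spine estimates (0/9 proved); BetaPertH ⇐ (D1) ∧ (D4) ∧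
CAP+tail; G-an2-4 gates asym, D1 and NE2/3/4.»  HONEST FRAMING (cell contract, verbatim): «discharging `BetaPertH` makes Bałaban's UV stability
UNCONDITIONAL — a real constructive-QFT result; it is NOT the continuum limit and NOT the Clay problem.»  THIS MODULE is [folklore] finite-dimensional calculus
over `FP/ValueFunctionThirdJet` (§1–§2: the branch identities and `d2ω_dotProduct`), an2's `ConstrainedCriticalMap` (`mulVecCLM`, `dotCLM`) and
`CompositionSingular` (`minOp`, `effForm`) BY NAME — the nonlinear-constraint, third-order sequel of an2's K-U5b `ConstrainedCriticalMapEnvelope`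
(`∇(A∘U) = −ω`, `Hess(A∘U) = effForm`).  NO estimate, NO lattice object, nothing of Bałaban's manuscripts, no definition, no `def … : Prop`, nothing cited,
0 sorry.  It discharges NOTHING of `hgerm`∕`hbook`∕`hasym`∕D1.  NOT D1, NOT BetaPertH, NOT continuum, NOT Clay.

ABSOLUTE RULE (cell charter, verbatim): «No internally-minted statement may enter as a cited fact. Every hypothesis is either kernel-proved in this
package or a verbatim quotation of a PUBLISHED theorem with page reference. The manuscript(s) under audit are NOT citable for their own disputed
steps — they are the thing under adjudication; programme-internal (2001/route/tribunal) claims are never citable.»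

THE ROW (owner, `H2V4-STATEMENT.md` §2, verbatim core): «`∂³S_j(𝟙)[a,b,c] = ∂³S_W(𝟙)[H_ja, H_jb, H_jc] − 3·Sym⟨Δ_j a, ∂²Q_j(𝟙)[H_jb, H_jc]⟩` (the second
term = the multiplier correction: `η′ = Δ_j a` is the value-function gradient's derivative; S3 of RHOA-DESIGN)».
WHAT IS PROVED (letters of `FP/ValueFunctionThirdJet`; all [folklore]): **`neg_d2ω_dotProduct_eq`** (the raw identity of `d2ω_dotProduct` in an2's
letters under `IsUnit (kkt H_c J_c).det`: `−(d2ω a a) ⬝ a = A‴[Ha,Ha,Ha] − 3·(Δa) ⬝ ∂²Q[Ha,Ha]`); **`hasFDerivAt_value`** (first-order envelope with a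
NONLINEAR constraint: `∇V(c) = −ω(c)` for `c` near `c₀` — twin of K-U5b `fderiv_comp_criticalMap`); **`fderiv_fderiv_value`** (`D²V(c)[d][e] = −(dω c d)
⬝ e` near `c₀`) and **`fderiv_fderiv_value_base`** (`Hess V(c₀) = Δ` — twin of K-U5b `fderiv_fderiv_comp_criticalMap`); **`hasDerivAt_thirdJet_value_line`** — THE ROW'S DISPLAY ON THE DIAGONAL
`a = b = c`: `s ↦ D²V(c₀ + s•a)[a][a]` has derivative `A‴[Ha,Ha,Ha] − 3·(Δa) ⬝ ∂²Q[Ha,Ha]` at `s = 0`.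
NOT HERE (honest): the polarised `[a,b,c]` form (symmetric-trilinear polarisation + the symmetry of `D³V` — a separate small file if the owner wants
it), existence of the branch for a nonlinear `Q`, the road instance `A = S_W`, `Q = Q_j` (rows H2V-4′-b∕c∕d), any estimate; 0∕4 row-D1 binders touched.
Provenance: NE9 formalisation swarm leaf seat `b2b-balaban-t4-ne9-formalise-leaf-04` gen 38 on cross-cell kernel duty (road «FP» row H2V-4′-a), 2026-08-21.
-/

noncomputable section

namespace Summit.QuantumFields.BalabanUV.Beta.FP.ValueFunctionThirdJetEnvelope

open Matrix Filter Topology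
open Literature.MathematicalPhysics.QuantumFieldTheory.Balaban1983to89.Beta.Composition (kkt)
open Literature.MathematicalPhysics.QuantumFieldTheory.Balaban1983to89.Beta.CompositionSingular (minOp effForm)
open Summit.QuantumFields.BalabanUV.Beta.ConstrainedCriticalMap (mulVecCLM mulVecCLM_apply dotCLM dotCLM_apply)
open Summit.QuantumFields.BalabanUV.Beta.FP.RootFixingGaugeForm (hasDerivAt_dax_line)
open Summit.QuantumFields.BalabanUV.Beta.FP.ValueFunctionThirdJet (hasDerivAt_dotProduct transpose_mulVec_dotProduct d2ω_dotProduct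
  dU_dω_eq_of_identities)

section Envelope

variable {κ μ : Type*} [Fintype κ] [Fintype μ] [DecidableEq κ] [DecidableEq μ]

/-! ## §3 In an2's letters; the value function `V := A ∘ U` -/

/-- [folklore] **THE THIRD-ORDER IDENTITY IN THE LETTERS OF `CompositionSingular`.**  Under the hypotheses of `d2ω_dotProduct` and the
non-degeneracy of the bordered matrix `kkt H_c J_c` (`H_c := Hf (U c₀)`, `J_c := Jf (U c₀)` as matrices): with `H a := minOp H_c J_c a` (the
minimiser's derivative) and `Δ a := effForm H_c J_c a` (the effective form = the value function's Hessian, `= −ω̇`),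
`−(d2ω a a) ⬝ a = A‴[Ha,Ha,Ha] − 3·(Δa) ⬝ ∂²Q[Ha,Ha]`. -/
theorem neg_d2ω_dotProduct_eq {f : (κ → ℝ) → (κ → ℝ)} {Hf : (κ → ℝ) → κ → κ → ℝ} {dH : (κ → ℝ) →L[ℝ] (κ → κ → ℝ)}
    {Q : (κ → ℝ) → (μ → ℝ)} {Jf : (κ → ℝ) → μ → κ → ℝ} {dJf : (κ → ℝ) → ((κ → ℝ) →L[ℝ] (μ → κ → ℝ))}
    {d2Jf : (κ → ℝ) →L[ℝ] (κ → ℝ) →L[ℝ] (μ → κ → ℝ)}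
    {U : (μ → ℝ) → (κ → ℝ)} {dU : (μ → ℝ) → ((μ → ℝ) →L[ℝ] (κ → ℝ))} {d2U : (μ → ℝ) →L[ℝ] (μ → ℝ) →L[ℝ] (κ → ℝ)}
    {ω : (μ → ℝ) → (μ → ℝ)} {dω : (μ → ℝ) → ((μ → ℝ) →L[ℝ] (μ → ℝ))} {d2ω : (μ → ℝ) →L[ℝ] (μ → ℝ) →L[ℝ] (μ → ℝ)} {c₀ : μ → ℝ}
    (hf : ∀ᶠ x in 𝓝 (U c₀), HasFDerivAt f (mulVecCLM (Matrix.of (Hf x))) x) (hH : HasFDerivAt Hf dH (U c₀))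
    (hsym : (Matrix.of (Hf (U c₀)))ᵀ = Matrix.of (Hf (U c₀)))
    (hQ : ∀ᶠ x in 𝓝 (U c₀), HasFDerivAt Q (mulVecCLM (Matrix.of (Jf x))) x) (hJ : ∀ᶠ x in 𝓝 (U c₀), HasFDerivAt Jf (dJf x) x)
    (hdJ : HasFDerivAt dJf d2Jf (U c₀))
    (hU : ∀ᶠ c in 𝓝 c₀, HasFDerivAt U (dU c) c) (hdU : HasFDerivAt dU d2U c₀)
    (hω : ∀ᶠ c in 𝓝 c₀, HasFDerivAt ω (dω c) c) (hdω : HasFDerivAt dω d2ω c₀)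
    (hid : ∀ᶠ c in 𝓝 c₀, f (U c) + (Matrix.of (Jf (U c)))ᵀ *ᵥ ω c = 0 ∧ Q (U c) = c) (hω0 : ω c₀ = 0)
    (hkkt : IsUnit (kkt (Matrix.of (Hf (U c₀))) (Matrix.of (Jf (U c₀)))).det) (a : μ → ℝ) :
    -(d2ω a a ⬝ᵥ a)
      = (Matrix.of (dH (minOp (Matrix.of (Hf (U c₀))) (Matrix.of (Jf (U c₀))) *ᵥ a))
            *ᵥ (minOp (Matrix.of (Hf (U c₀))) (Matrix.of (Jf (U c₀))) *ᵥ a))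
          ⬝ᵥ (minOp (Matrix.of (Hf (U c₀))) (Matrix.of (Jf (U c₀))) *ᵥ a)
        - 3 * ((effForm (Matrix.of (Hf (U c₀))) (Matrix.of (Jf (U c₀))) *ᵥ a)
          ⬝ᵥ (Matrix.of (dJf (U c₀) (minOp (Matrix.of (Hf (U c₀))) (Matrix.of (Jf (U c₀))) *ᵥ a))
            *ᵥ (minOp (Matrix.of (Hf (U c₀))) (Matrix.of (Jf (U c₀))) *ᵥ a))) := by
  have h := d2ω_dotProduct hf hH hsym hQ hJ hdJ hU hdU hω hdω hid hω0 a
  obtain ⟨hUa, hωa⟩ := dU_dω_eq_of_identities hf hQ hJ hU hω hid hω0 hkkt a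
  rw [hUa, hωa, neg_dotProduct] at h
  rw [h]
  ring

/-- [folklore] **FIRST-ORDER ENVELOPE WITH A NONLINEAR CONSTRAINT** (twin of an2's K-U5b `fderiv_comp_criticalMap`): if `f` is the gradient of `A` along the
branch (`HasFDerivAt A (dotCLM (f (U c))) (U c)` for `c` near `c₀`), then for `c` near `c₀` the value function `V := A ∘ U` has `∇V(c) = −ω(c)`. -/
theorem hasFDerivAt_value {A : (κ → ℝ) → ℝ} {f : (κ → ℝ) → (κ → ℝ)} {Q : (κ → ℝ) → (μ → ℝ)} {Jf : (κ → ℝ) → μ → κ → ℝ}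
    {U : (μ → ℝ) → (κ → ℝ)} {dU : (μ → ℝ) → ((μ → ℝ) →L[ℝ] (κ → ℝ))} {ω : (μ → ℝ) → (μ → ℝ)} {c₀ : μ → ℝ}
    (hA : ∀ᶠ c in 𝓝 c₀, HasFDerivAt A (dotCLM (f (U c))) (U c))
    (hQ : ∀ᶠ x in 𝓝 (U c₀), HasFDerivAt Q (mulVecCLM (Matrix.of (Jf x))) x) (hU : ∀ᶠ c in 𝓝 c₀, HasFDerivAt U (dU c) c)
    (hid : ∀ᶠ c in 𝓝 c₀, f (U c) + (Matrix.of (Jf (U c)))ᵀ *ᵥ ω c = 0 ∧ Q (U c) = c) :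
    ∀ᶠ c in 𝓝 c₀, HasFDerivAt (A ∘ U) (-dotCLM (ω c)) c := by
  have hUc : ContinuousAt U c₀ := hU.self_of_nhds.continuousAt
  have hQ' : ∀ᶠ c in 𝓝 c₀, HasFDerivAt Q (mulVecCLM (Matrix.of (Jf (U c)))) (U c) := hUc.eventually hQ
  filter_upwards [hA, hQ', hU, hid.eventually_nhds] with c hAc hQc hUc' hidc
  have hcomp : HasFDerivAt (A ∘ U) ((dotCLM (f (U c))).comp (dU c)) c := hAc.comp c hUc'
  -- `J(U c) ∘ dU c = id` from the constraint
  have hd2 : HasFDerivAt (fun c' => Q (U c')) ((mulVecCLM (Matrix.of (Jf (U c)))).comp (dU c)) c := hQc.comp c hUc'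
  have hz2 : HasFDerivAt (fun c' => Q (U c')) (ContinuousLinearMap.id ℝ (μ → ℝ)) c :=
    (hasFDerivAt_id c).congr_of_eventuallyEq (hidc.mono fun c' h => h.2)
  have e2 := hd2.unique hz2
  have p2 : ∀ d, Matrix.of (Jf (U c)) *ᵥ dU c d = d := fun d => by
    have := congrArg (fun L : (μ → ℝ) →L[ℝ] (μ → ℝ) => L d) e2
    simpa using this
  have hfc : f (U c) = -((Matrix.of (Jf (U c)))ᵀ *ᵥ ω c) := eq_neg_of_add_eq_zero_left (hidc.self_of_nhds).1
  refine hcomp.congr_fderiv ?_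
  ext d : 1
  simp only [ContinuousLinearMap.comp_apply, dotCLM_apply, _root_.neg_apply, hfc, neg_dotProduct,
    transpose_mulVec_dotProduct, p2]

/-- [folklore] **SECOND-ORDER ENVELOPE, NEAR THE BASE POINT**: `D²V(c)[d][e] = −(dω c d) ⬝ e` for `c` near `c₀` (so `Hess V(c₀) = Δ` by §1). -/
theorem fderiv_fderiv_value {A : (κ → ℝ) → ℝ} {f : (κ → ℝ) → (κ → ℝ)} {Q : (κ → ℝ) → (μ → ℝ)} {Jf : (κ → ℝ) → μ → κ → ℝ}
    {U : (μ → ℝ) → (κ → ℝ)} {dU : (μ → ℝ) → ((μ → ℝ) →L[ℝ] (κ → ℝ))} {ω : (μ → ℝ) → (μ → ℝ)}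
    {dω : (μ → ℝ) → ((μ → ℝ) →L[ℝ] (μ → ℝ))} {c₀ : μ → ℝ}
    (hA : ∀ᶠ c in 𝓝 c₀, HasFDerivAt A (dotCLM (f (U c))) (U c))
    (hQ : ∀ᶠ x in 𝓝 (U c₀), HasFDerivAt Q (mulVecCLM (Matrix.of (Jf x))) x) (hU : ∀ᶠ c in 𝓝 c₀, HasFDerivAt U (dU c) c)
    (hω : ∀ᶠ c in 𝓝 c₀, HasFDerivAt ω (dω c) c)
    (hid : ∀ᶠ c in 𝓝 c₀, f (U c) + (Matrix.of (Jf (U c)))ᵀ *ᵥ ω c = 0 ∧ Q (U c) = c) :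
    ∀ᶠ c in 𝓝 c₀, HasFDerivAt (fderiv ℝ (A ∘ U)) (-((dotCLM : (μ → ℝ) →L[ℝ] (μ → ℝ) →L[ℝ] ℝ).comp (dω c))) c
      ∧ ∀ d e, fderiv ℝ (fderiv ℝ (A ∘ U)) c d e = -(dω c d ⬝ᵥ e) := by
  have h1 := (hasFDerivAt_value hA hQ hU hid).eventually_nhds
  filter_upwards [h1, hω] with c h1c hωc
  have heq : fderiv ℝ (A ∘ U) =ᶠ[𝓝 c] fun c' => -dotCLM (ω c') := h1c.mono fun c' h => h.fderiv
  have h2 : HasFDerivAt (fun c' => -dotCLM (ω c')) (-((dotCLM : (μ → ℝ) →L[ℝ] (μ → ℝ) →L[ℝ] ℝ).comp (dω c))) c :=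
    ((dotCLM : (μ → ℝ) →L[ℝ] (μ → ℝ) →L[ℝ] ℝ).hasFDerivAt.comp c hωc).neg
  have h3 := h2.congr_of_eventuallyEq heq
  refine ⟨h3, fun d e => ?_⟩
  rw [h3.fderiv]
  simp

/-- [folklore] **`Hess V(c₀) = Δ`** at the tadpole-free base point (nonlinear twin of an2's K-U5b `fderiv_fderiv_comp_criticalMap`):
`D²V(c₀)[d][e] = (effForm H_c J_c d) ⬝ e`. -/
theorem fderiv_fderiv_value_base {A : (κ → ℝ) → ℝ} {f : (κ → ℝ) → (κ → ℝ)} {Hf : (κ → ℝ) → κ → κ → ℝ} {Q : (κ → ℝ) → (μ → ℝ)}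
    {Jf : (κ → ℝ) → μ → κ → ℝ} {dJf : (κ → ℝ) → ((κ → ℝ) →L[ℝ] (μ → κ → ℝ))} {U : (μ → ℝ) → (κ → ℝ)}
    {dU : (μ → ℝ) → ((μ → ℝ) →L[ℝ] (κ → ℝ))} {ω : (μ → ℝ) → (μ → ℝ)} {dω : (μ → ℝ) → ((μ → ℝ) →L[ℝ] (μ → ℝ))} {c₀ : μ → ℝ}
    (hA : ∀ᶠ c in 𝓝 c₀, HasFDerivAt A (dotCLM (f (U c))) (U c))
    (hf : ∀ᶠ x in 𝓝 (U c₀), HasFDerivAt f (mulVecCLM (Matrix.of (Hf x))) x)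
    (hQ : ∀ᶠ x in 𝓝 (U c₀), HasFDerivAt Q (mulVecCLM (Matrix.of (Jf x))) x) (hJ : ∀ᶠ x in 𝓝 (U c₀), HasFDerivAt Jf (dJf x) x)
    (hU : ∀ᶠ c in 𝓝 c₀, HasFDerivAt U (dU c) c) (hω : ∀ᶠ c in 𝓝 c₀, HasFDerivAt ω (dω c) c)
    (hid : ∀ᶠ c in 𝓝 c₀, f (U c) + (Matrix.of (Jf (U c)))ᵀ *ᵥ ω c = 0 ∧ Q (U c) = c) (hω0 : ω c₀ = 0)
    (hkkt : IsUnit (kkt (Matrix.of (Hf (U c₀))) (Matrix.of (Jf (U c₀)))).det) (d e : μ → ℝ) :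
    fderiv ℝ (fderiv ℝ (A ∘ U)) c₀ d e = (effForm (Matrix.of (Hf (U c₀))) (Matrix.of (Jf (U c₀))) *ᵥ d) ⬝ᵥ e := by
  have h2 := (fderiv_fderiv_value hA hQ hU hω hid).self_of_nhds
  rw [h2.2 d e, (dU_dω_eq_of_identities hf hQ hJ hU hω hid hω0 hkkt d).2, neg_dotProduct, neg_neg]

/-- [folklore] **`D³V(c₀)[a,a,a] = A‴[Ha,Ha,Ha] − 3·(Δa) ⬝ ∂²Q[Ha,Ha]`** — H2V4-STATEMENT §2's display
`∂³S_j(𝟙)[a,b,c] = ∂³S_W(𝟙)[H_ja,H_jb,H_jc] − 3·Sym⟨Δ_j a, ∂²Q_j(𝟙)[H_jb,H_jc]⟩` ON THE DIAGONAL, at matrix level: along the line `c₀ + s•a` the second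
derivative `s ↦ D²V(c₀ + s•a)[a][a]` of the tree-level effective action `V := A ∘ U` has derivative at `s = 0` equal to the display, with `H := minOp H_c J_c`,
`Δ := effForm H_c J_c`, `A‴[v,w,z] := ((Matrix.of (dH v)) *ᵥ w) ⬝ᵥ z`, `∂²Q[v,w] := (Matrix.of (dJf (U c₀) v)) *ᵥ w`.  Hypotheses: the two identities of
the branch near `c₀`, the jets displayed in §1–§2, the tadpole-free base point `ω c₀ = 0`, `kkt H_c J_c` nonsingular.  (Existence of the branch for a
nonlinear `Q`, the road instance `A = S_W`, `Q = Q_j`, and the polarised `[a,b,c]` form are NOT here.) -/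
theorem hasDerivAt_thirdJet_value_line {A : (κ → ℝ) → ℝ} {f : (κ → ℝ) → (κ → ℝ)} {Hf : (κ → ℝ) → κ → κ → ℝ}
    {dH : (κ → ℝ) →L[ℝ] (κ → κ → ℝ)} {Q : (κ → ℝ) → (μ → ℝ)} {Jf : (κ → ℝ) → μ → κ → ℝ} {dJf : (κ → ℝ) → ((κ → ℝ) →L[ℝ] (μ → κ → ℝ))}
    {d2Jf : (κ → ℝ) →L[ℝ] (κ → ℝ) →L[ℝ] (μ → κ → ℝ)}
    {U : (μ → ℝ) → (κ → ℝ)} {dU : (μ → ℝ) → ((μ → ℝ) →L[ℝ] (κ → ℝ))} {d2U : (μ → ℝ) →L[ℝ] (μ → ℝ) →L[ℝ] (κ → ℝ)}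
    {ω : (μ → ℝ) → (μ → ℝ)} {dω : (μ → ℝ) → ((μ → ℝ) →L[ℝ] (μ → ℝ))} {d2ω : (μ → ℝ) →L[ℝ] (μ → ℝ) →L[ℝ] (μ → ℝ)} {c₀ : μ → ℝ}
    (hA : ∀ᶠ c in 𝓝 c₀, HasFDerivAt A (dotCLM (f (U c))) (U c))
    (hf : ∀ᶠ x in 𝓝 (U c₀), HasFDerivAt f (mulVecCLM (Matrix.of (Hf x))) x) (hH : HasFDerivAt Hf dH (U c₀))
    (hsym : (Matrix.of (Hf (U c₀)))ᵀ = Matrix.of (Hf (U c₀)))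
    (hQ : ∀ᶠ x in 𝓝 (U c₀), HasFDerivAt Q (mulVecCLM (Matrix.of (Jf x))) x) (hJ : ∀ᶠ x in 𝓝 (U c₀), HasFDerivAt Jf (dJf x) x)
    (hdJ : HasFDerivAt dJf d2Jf (U c₀))
    (hU : ∀ᶠ c in 𝓝 c₀, HasFDerivAt U (dU c) c) (hdU : HasFDerivAt dU d2U c₀)
    (hω : ∀ᶠ c in 𝓝 c₀, HasFDerivAt ω (dω c) c) (hdω : HasFDerivAt dω d2ω c₀)
    (hid : ∀ᶠ c in 𝓝 c₀, f (U c) + (Matrix.of (Jf (U c)))ᵀ *ᵥ ω c = 0 ∧ Q (U c) = c) (hω0 : ω c₀ = 0)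
    (hkkt : IsUnit (kkt (Matrix.of (Hf (U c₀))) (Matrix.of (Jf (U c₀)))).det) (a : μ → ℝ) :
    HasDerivAt (fun s : ℝ => fderiv ℝ (fderiv ℝ (A ∘ U)) (c₀ + s • a) a a)
      ((Matrix.of (dH (minOp (Matrix.of (Hf (U c₀))) (Matrix.of (Jf (U c₀))) *ᵥ a))
            *ᵥ (minOp (Matrix.of (Hf (U c₀))) (Matrix.of (Jf (U c₀))) *ᵥ a))
          ⬝ᵥ (minOp (Matrix.of (Hf (U c₀))) (Matrix.of (Jf (U c₀))) *ᵥ a)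
        - 3 * ((effForm (Matrix.of (Hf (U c₀))) (Matrix.of (Jf (U c₀))) *ᵥ a)
          ⬝ᵥ (Matrix.of (dJf (U c₀) (minOp (Matrix.of (Hf (U c₀))) (Matrix.of (Jf (U c₀))) *ᵥ a))
            *ᵥ (minOp (Matrix.of (Hf (U c₀))) (Matrix.of (Jf (U c₀))) *ᵥ a)))) 0 := by
  -- near `c₀` the second derivative is `−(dω c a) ⬝ a`; pull back along the line
  have h2 := fderiv_fderiv_value hA hQ hU hω hid
  have hline : ∀ s : ℝ, HasDerivAt (fun s : ℝ => c₀ + s • a) a s := fun s => by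
    have h := ((hasDerivAt_id s).smul_const a).const_add c₀
    rwa [one_smul] at h
  have hcont : Tendsto (fun s : ℝ => c₀ + s • a) (𝓝 0) (𝓝 c₀) := by
    have h := (hline 0).continuousAt.tendsto
    rwa [zero_smul, add_zero] at h
  have heq : (fun s : ℝ => fderiv ℝ (fderiv ℝ (A ∘ U)) (c₀ + s • a) a a) =ᶠ[𝓝 0] fun s : ℝ => -(dω (c₀ + s • a) a ⬝ᵥ a) := by
    filter_upwards [hcont.eventually h2] with s hs
    exact hs.2 a a
  -- differentiate `s ↦ −(dω (c₀ + s•a) a ⬝ a)` at 0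
  have hw₁ : HasDerivAt (fun s : ℝ => dω (c₀ + s • a) a) (d2ω a a) 0 := hasDerivAt_dax_line hdω a
  have hd : HasDerivAt (fun s : ℝ => -(dω (c₀ + s • a) a ⬝ᵥ a)) (-(d2ω a a ⬝ᵥ a)) 0 := by
    have h := (hasDerivAt_dotProduct hw₁ (hasDerivAt_const (0 : ℝ) a)).neg
    refine h.congr_deriv ?_
    rw [dotProduct_zero, add_zero]
  refine (hd.congr_of_eventuallyEq heq).congr_deriv ?_
  exact neg_d2ω_dotProduct_eq hf hH hsym hQ hJ hdJ hU hdU hω hdω hid hω0 hkkt a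

end Envelope

end Summit.QuantumFields.BalabanUV.Beta.FP.ValueFunctionThirdJetEnvelope

end
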